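import Summits.HodgeConjecture.HodgeConjecture.Theorems.HLiu418ScalarSpectralJunction
import Summits.HodgeConjecture.HodgeConjecture.Theorems.F0P3HilbertProjection
import Literature.NumberTheory.Automorphic.UnitaryCurveCohCotangentForms
import Literature.NumberTheory.Automorphic.HilbertRepOrthogonalDecomposition
import Literature.NumberTheory.Automorphic.DiscreteDecompositionCriterion
import HarnessLib

/-!
# Crux `HLiu418`, line `F0_AlbCm` — «all projections but THE `P₀` vanish ⇒ the class lies in `P₀`» WITHOUT MULTIPLICITY ONE, and the
# generic core «one line of `A`-valued intertwiners» WITHOUT MULTIPLICITY ONE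

Floor-0 programme P5 (Alb-CM), seat F0P5-p03 (g2); crux item stmt-HodgeConjecture-24832 (`HCCMUnconditional.HLiu418`).  Letter-free,
`sorry`-free, theorems only.  HC_CM is proved only modulo the 7 printed citations until rung 0 closes.

WHY THIS FILE (PLAN v2 input of the P5 desk: «where does the printed letter E1₂ = [Rogawski1990 §11] multiplicity `≤ 1` enter?»).  In the tree
the letter E1₂ `Rogawski1990.curveMultiplicityLeOne` is consumed at exactly ONE kernel point: ★ `S1BettiSliceLines.stub_L10∕L01_of_letters` turn it
into `h1 : HasMultiplicityOne (rightRegular μ)` for ★ `IntertwiningLineOfLetters.exists_intertwiningLine_of_letters`, which uses `h1` once, through ★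
`F0P3StubS3Fold.mem_space_of_forall_detected_eq` («every discrete `P` not orthogonal to `v` equals `P₀` ⇒ `v ∈ P₀`»), which uses it once, for
«`P ≠ P₀ ⇒ P ⊥ P₀`».  That orthogonality is NOT needed: write `v = p + u` with `p = pr_{P₀} v`, `u ∈ P₀ᗮ`; if `u ≠ 0`, the closed invariant
subspace `P₀ᗮ ∩ Annᗮ` (`Ann` = vectors orthogonal to every translate of `u`; it contains `u`) contains an irreducible closed invariant `W`
(★ `IsUnitary.exists_isTopIrreducible_le_of_isDiscretelyDecomposable`, [Dixmier1977, 5.4.1]); `W ⊄ Ann`, so some `y ∈ W` pairs with a translate of `u`,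
hence (unitarity) some `y′ ∈ W` has `⟪y′, u⟫ ≠ 0`, so `⟪y′, v⟫ = ⟪y′, u⟫ ≠ 0` (`y′ ⊥ p`); the hypothesis gives `W = P₀`, so `y′ ∈ P₀ ∩ P₀ᗮ = 0` —
contradiction.  Consequently the generic core holds WITHOUT `h1`, and the P5 line folds (L10)∕(L01)
need the letter E1₂ ONLY through E1′ (uniqueness of the cohomological finite component) — see `Theorems/HLiu418S1BettiSliceLinesNoE1.lean`.

* `mem_space_of_forall_detected_eq_of_isUnitary` — ★ `F0P3StubS3Fold.mem_space_of_forall_detected_eq` minus the hypothesis `HasMultiplicityOne`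
  (generic `AdelicGroupData`; unitarity of `rightRegular` is ★ `isUnitary_rightRegular`);
* `exists_intertwiningLine_of_letters'` — ★ `IntertwiningLineOfLetters.exists_intertwiningLine_of_letters` minus the hypothesis `h1`, proof
  otherwise token for token.

References: [Dixmier1977] §5.4 (5.4.1), §13.1; [BorelJacquet1979] §4.6; [DeitmarEchterhoff2014] §6.1 (cyclic vectors); [Liu2021] proof of Prop. D.4 (1)
p. 130–131; [Rogawski1990] §11.
-/

set_option autoImplicit false
-- the mandated namespace repeats `HodgeConjecture.HodgeConjecture`, as in every `Theorems/*.lean` of this sub-problem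
set_option linter.dupNamespace false

noncomputable section

namespace Summit.HodgeConjecture.HodgeConjecture.Cruxes.HLiu418.DetectedEqUnitary

open scoped InnerProductSpace ENNReal
open MeasureTheory NumberField
open Literature.NumberTheory.Automorphic Literature.NumberTheory.Automorphic.UnitaryGroup Literature.NumberTheory.Automorphic.UnitaryCurveForms
open Literature.NumberTheory.Automorphic.UnitaryGroup.CotangentForms (toQuotFun toQuotFun_mk)
open Summit.HodgeConjecture.HodgeConjecture.Cruxes.H413.F0P3HilbertProjection
open Summit.HodgeConjecture.HodgeConjecture.Cruxes.H413.SpectrumJunction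
open Summit.HodgeConjecture.HodgeConjecture.Cruxes.HLiu418.ScalarSpectralJunction

/-! ## §1 «All projections but THE `P₀` vanish ⇒ the class lies in `P₀`» — no multiplicity one -/

section Detected

variable {K : Type} [Field K] [NumberField K] {𝒢 : AdelicGroupData.{0} K}
  {μ : Measure 𝒢.automorphicQuotient} [SMulInvariantMeasure 𝒢.Adelic 𝒢.automorphicQuotient μ]

/-- **«All projections but THE `P₀` vanish ⇒ the class lies in `P₀`», WITHOUT multiplicity one.**  In a discretely decomposable
`L²(G(K)\G(𝔸_K), μ)`: if EVERY discrete (irreducible closed invariant) `P` not orthogonal to `v` equals `P₀`, then `v ∈ P₀`.  Proof: `v = pr_{P₀} v + u`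
with `u ∈ P₀ᗮ`, a closed invariant subspace (★ `isUnitary_rightRegular`); were `u ≠ 0`, the closed subrepresentation generated by `u` (inside `P₀ᗮ`)
— more precisely `Q := P₀ᗮ ∩ Annᗮ`, `Ann` the closed invariant subspace of vectors orthogonal to every translate of `u`, `u ∈ Q` — would contain an
irreducible closed `W` ([Dixmier1977, 5.4.1], ★ `IsUnitary.exists_isTopIrreducible_le_of_isDiscretelyDecomposable`); `W ⊄ Ann` (else `W ≤ Ann ∩ Annᗮ = 0`),
so some `y ∈ W` pairs with a translate of `u`; moving the translate to the `W` side gives `y′ ∈ W ⊆ P₀ᗮ` with `⟪y′, v⟫ = ⟪y′, u⟫ ≠ 0`, so `W = P₀` by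
hypothesis and `y′ ∈ P₀ ∩ P₀ᗮ = 0` — contradiction.
[cite: Dixmier1977, §5.4 (5.4.1) and §13.1] [cite: BorelJacquet1979, §4.6] [cite: DeitmarEchterhoff2014, §6.1] -/
theorem mem_space_of_forall_detected_eq_of_isUnitary (hdisc : (𝒢.rightRegular μ).IsDiscretelyDecomposable)
    (P₀ : DiscreteAutomorphicRep 𝒢 μ) (v : 𝒢.L2 μ)
    (huniq : ∀ P : DiscreteAutomorphicRep 𝒢 μ, (∃ u ∈ P.space, ⟪(u : 𝒢.L2 μ), v⟫_ℂ ≠ 0) → P = P₀) :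
    v ∈ P₀.space.toSubmodule := by
  have hπ : (𝒢.rightRegular μ).IsUnitary := 𝒢.isUnitary_rightRegular μ
  set p : 𝒢.L2 μ := (P₀.space.toSubmodule.orthogonalProjectionOnto v : 𝒢.L2 μ) with hp
  have hpmem : p ∈ P₀.space.toSubmodule := (P₀.space.toSubmodule.orthogonalProjectionOnto v).2
  have hu_orth : v - p ∈ (P₀.space.toSubmodule)ᗮ := by
    rw [hp, ← Submodule.starProjection_apply]
    exact Submodule.sub_starProjection_mem_orthogonal v
  by_cases hu : v - p = 0
  · rw [sub_eq_zero] at hu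
    rw [hu]
    exact hpmem
  exfalso
  set u : 𝒢.L2 μ := v - p with hudef
  -- the closed invariant subspace `Ann` of vectors orthogonal to every translate `R g u`
  let Ann : ContRepresentation.ClosedSubrep (𝒢.rightRegular μ) :=
    { toSubmodule := ⨅ g : 𝒢.Adelic, (ℂ ∙ ((𝒢.rightRegular μ) g u))ᗮ
      apply_mem_toSubmodule := fun h z hz => by
        change (𝒢.rightRegular μ) h z ∈ (⨅ g : 𝒢.Adelic, (ℂ ∙ ((𝒢.rightRegular μ) g u))ᗮ)
        change z ∈ (⨅ g : 𝒢.Adelic, (ℂ ∙ ((𝒢.rightRegular μ) g u))ᗮ) at hz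
        rw [Submodule.mem_iInf] at hz ⊢
        intro g
        rw [Submodule.mem_orthogonal_singleton_iff_inner_right]
        have hg := hz (h⁻¹ * g)
        rw [Submodule.mem_orthogonal_singleton_iff_inner_right] at hg
        -- `⟪R g u, R h z⟫ = ⟪R h⁻¹ (R g u), R h⁻¹ (R h z)⟫ = ⟪R (h⁻¹ g) u, z⟫`
        have h1 : (𝒢.rightRegular μ) h⁻¹ ((𝒢.rightRegular μ) g u) = (𝒢.rightRegular μ) (h⁻¹ * g) u := by
          rw [map_mul]; rfl
        have h2 : (𝒢.rightRegular μ) h⁻¹ ((𝒢.rightRegular μ) h z) = z := by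
          rw [show (𝒢.rightRegular μ) h⁻¹ ((𝒢.rightRegular μ) h z) = ((𝒢.rightRegular μ) h⁻¹ * (𝒢.rightRegular μ) h) z from rfl,
            ← map_mul, inv_mul_cancel, map_one]
          rfl
        rw [← hπ.inner_map_map h⁻¹, h1, h2]
        exact hg
      isClosed' := by
        change IsClosed ((⨅ g : 𝒢.Adelic, (ℂ ∙ ((𝒢.rightRegular μ) g u))ᗮ : Submodule ℂ (𝒢.L2 μ)) : Set (𝒢.L2 μ))
        rw [Submodule.coe_iInf]
        exact isClosed_iInter fun g => Submodule.isClosed_orthogonal _ }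
  have hAnn_mem : ∀ z : 𝒢.L2 μ, z ∈ Ann ↔ ∀ g : 𝒢.Adelic, ⟪(𝒢.rightRegular μ) g u, z⟫_ℂ = 0 := fun z => by
    change z ∈ (⨅ g : 𝒢.Adelic, (ℂ ∙ ((𝒢.rightRegular μ) g u))ᗮ) ↔ _
    rw [Submodule.mem_iInf]
    exact forall_congr' fun g => Submodule.mem_orthogonal_singleton_iff_inner_right
  -- `Q := P₀ᗮ ∩ Annᗮ` is closed invariant and contains `u ≠ 0`
  set Q : ContRepresentation.ClosedSubrep (𝒢.rightRegular μ) := (P₀.space.orthogonal hπ).inter (Ann.orthogonal hπ) with hQ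
  have huQ : u ∈ Q := by
    refine ⟨hu_orth, ?_⟩
    change u ∈ Ann.toSubmoduleᗮ
    rw [Submodule.mem_orthogonal]
    intro z hz
    have h1 := (hAnn_mem z).mp hz 1
    have h2 : (𝒢.rightRegular μ) 1 u = u := by rw [map_one]; rfl
    rw [h2] at h1
    rw [← inner_conj_symm, h1, map_zero]
  have hQne : Q ≠ ⊥ := by
    intro hbot
    rw [hbot] at huQ
    exact hu ((ContRepresentation.ClosedSubrep.mem_bot).mp huQ)
  -- an irreducible closed `W ≤ Q` (Dixmier 5.4.1)
  obtain ⟨W, hWirr, hWQ⟩ := hπ.exists_isTopIrreducible_le_of_isDiscretelyDecomposable hdisc hQne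
  -- `W` is not orthogonal to the orbit of `u` (else `W ≤ Ann ∩ Annᗮ = 0`)
  obtain ⟨y, hyW, g, hg⟩ : ∃ y ∈ W, ∃ g : 𝒢.Adelic, ⟪(𝒢.rightRegular μ) g u, y⟫_ℂ ≠ 0 := by
    by_contra hnone
    push Not at hnone
    apply ContRepresentation.ClosedSubrep.ne_bot_of_isTopIrreducible hWirr
    refine ContRepresentation.ClosedSubrep.ext fun z => ⟨fun hz => ?_, fun hz => ?_⟩
    · have hzA : z ∈ Ann := (hAnn_mem z).mpr (hnone z hz)
      have hzA' : z ∈ Ann.toSubmoduleᗮ := (hWQ hz).2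
      have h0 : ⟪z, z⟫_ℂ = 0 := Submodule.inner_left_of_mem_orthogonal hzA hzA'
      rw [inner_self_eq_zero] at h0
      exact (ContRepresentation.ClosedSubrep.mem_bot).mpr h0
    · rw [(ContRepresentation.ClosedSubrep.mem_bot).mp hz]
      exact W.toSubmodule.zero_mem
  -- move the translate to the `W` side: `y' := R g⁻¹ y ∈ W`, `⟪y', u⟫ ≠ 0`
  set y' : 𝒢.L2 μ := (𝒢.rightRegular μ) g⁻¹ y with hy'
  have hy'W : y' ∈ W := W.apply_mem g⁻¹ hyW
  have hy'u : ⟪y', u⟫_ℂ ≠ 0 := by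
    intro h0
    apply hg
    have h1 : ⟪u, y'⟫_ℂ = ⟪(𝒢.rightRegular μ) g u, y⟫_ℂ := by
      rw [hy', ← hπ.adjoint_apply g, ContinuousLinearMap.adjoint_inner_right]
    rw [← h1, ← inner_conj_symm, h0, map_zero]
  -- `y' ⊥ p`, so `⟪y', v⟫ = ⟪y', u⟫ ≠ 0`
  have hy'orth : y' ∈ (P₀.space.toSubmodule)ᗮ := (hWQ hy'W).1
  have hy'p : ⟪y', p⟫_ℂ = 0 := Submodule.inner_left_of_mem_orthogonal hpmem hy'orth
  have hy'v : ⟪y', v⟫_ℂ ≠ 0 := by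
    have : ⟪y', v⟫_ℂ = ⟪y', u⟫_ℂ := by rw [hudef, inner_sub_right, hy'p, sub_zero]
    rw [this]
    exact hy'u
  -- hence `W = P₀`, and `y' ∈ P₀ ∩ P₀ᗮ = 0`
  have hWP : (⟨W, hWirr⟩ : DiscreteAutomorphicRep 𝒢 μ) = P₀ := huniq ⟨W, hWirr⟩ ⟨y', hy'W, hy'v⟩
  have hy'P : y' ∈ P₀.space.toSubmodule := by
    have : W = P₀.space := congrArg DiscreteAutomorphicRep.space hWP
    exact this ▸ hy'W
  have hy'0 : y' = 0 := by
    have := Submodule.inner_left_of_mem_orthogonal hy'P hy'orth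
    rwa [inner_self_eq_zero] at this
  exact hy'v (by rw [hy'0, inner_zero_left])

end Detected

/-! ## §2 The generic core WITHOUT multiplicity one (★ `IntertwiningLineOfLetters.exists_intertwiningLine_of_letters` minus `h1`) -/

section Core

variable {F₀ E : Type} [Field F₀] [NumberField F₀] [Field E] [NumberField E] [Algebra F₀ E]
  {c : E ≃ₐ[F₀] E} {J : Matrix (Fin 2) (Fin 2) E}
  {μ : Measure (adelicGroupData F₀ E c 2 J).automorphicQuotient} [(adelicGroupData F₀ E c 2 J).IsAutomorphicMeasure μ]
  [CompactSpace (adelicGroupData F₀ E c 2 J).automorphicQuotient]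

/-- **GENERIC CORE — one line of `A`-valued intertwiners, WITHOUT multiplicity one.**  `U(J)(L)\U(J)(𝔸)` compact, `L²(μ)` discretely decomposable
(no multiplicity hypothesis); `σ` IRREDUCIBLE on `W`; `A` a submodule of scalar functions whose members are left-`U(J)(L)`-invariant and continuous;
`typeA P` a property of discrete `P` such that (detection) a discrete `P` not orthogonal to the class of a member of `A` has `typeA`, (uniqueness) at most
one `typeA` discrete `P` has finite component `σ`, and (isotypic line) for every discrete `P` the `rightRep₂`-equivariant linear `ψ : W → (U(J)(𝔸) → ℂ)`
valued in `A` and contained in `P` lie on one line.  THEN the intertwiners `σ → rightRep₂` valued in `A` lie on one line.  Proof = ★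
`exists_intertwiningLine_of_letters` token for token with `mem_space_of_forall_detected_eq_of_isUnitary` (§1) in place of ★
`F0P3StubS3Fold.mem_space_of_forall_detected_eq`. [cite: BorelJacquet1979, §4.6] [cite: Dixmier1977, §5.4] -/
theorem exists_intertwiningLine_of_letters' (hdisc : ((adelicGroupData F₀ E c 2 J).rightRegular μ).IsDiscretelyDecomposable)
    {W : Type} [AddCommGroup W] [Module ℂ W] (σ : Representation ℂ (finAdelic F₀ E c 2 J) W) (hσ : σ.IsIrreducible)
    (A : Submodule ℂ ((adelicGroupData F₀ E c 2 J).Adelic → ℂ))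
    (hleft : ∀ f ∈ A, ∀ γ ∈ (adelicGroupData F₀ E c 2 J).quotientSubgroup, ∀ x, f (γ * x) = f x)
    (hcontA : ∀ f ∈ A, Continuous f)
    (typeA : DiscreteAutomorphicRep (adelicGroupData F₀ E c 2 J) μ → Prop)
    (hdet : ∀ (P : DiscreteAutomorphicRep (adelicGroupData F₀ E c 2 J) μ) (f : (adelicGroupData F₀ E c 2 J).Adelic → ℂ), f ∈ A →
      ∀ hf : MemLp (toQuotFun (adelicGroupData F₀ E c 2 J) f) 2 μ,
        (∃ u ∈ P.space, ⟪(u : (adelicGroupData F₀ E c 2 J).L2 μ), hf.toLp⟫_ℂ ≠ 0) → typeA P)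
    (huniq : ∀ P P' : DiscreteAutomorphicRep (adelicGroupData F₀ E c 2 J) μ,
      typeA P → typeA P' → P.HasFinComponent σ → P'.HasFinComponent σ → P = P')
    (hline : ∀ P : DiscreteAutomorphicRep (adelicGroupData F₀ E c 2 J) μ,
      ∃ ψ₀ : W →ₗ[ℂ] ((adelicGroupData F₀ E c 2 J).Adelic → ℂ), ∀ ψ : W →ₗ[ℂ] ((adelicGroupData F₀ E c 2 J).Adelic → ℂ),
        (∀ (g : finAdelic F₀ E c 2 J) (w : W), ψ (σ g w) = rightRep₂ F₀ E c J g (ψ w)) →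
        (∀ w : W, ψ w ∈ A ∧ P.ContainsFun (ψ w)) → ∃ r : ℂ, ψ = r • ψ₀) :
    ∃ ψ₀ : σ.IntertwiningMap (rightRep₂ F₀ E c J), ∀ ψ : σ.IntertwiningMap (rightRep₂ F₀ E c J),
      (∀ w, ψ w ∈ A) → ∃ a : ℂ, ψ = a • ψ₀ := by
  haveI := hσ
  -- the degenerate case: no non-zero `A`-valued intertwiner
  by_cases hex : ∃ ψ₁ : σ.IntertwiningMap (rightRep₂ F₀ E c J), (∀ w, ψ₁ w ∈ A) ∧ ψ₁ ≠ 0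
  swap
  · refine ⟨0, fun ψ hψ => ⟨0, ?_⟩⟩
    have hψ0 : ψ = 0 := by
      by_contra hne
      exact hex ⟨ψ, hψ, hne⟩
    rw [hψ0, smul_zero]
  obtain ⟨ψ₁, hψ₁v, hψ₁0⟩ := hex
  -- bookkeeping for `A`-valued intertwiners: equivariance on values, `L²` classes, finite component and type of the discrete `P` they meet
  have heqv : ∀ (ψ : σ.IntertwiningMap (rightRep₂ F₀ E c J)) (g : finAdelic F₀ E c 2 J) (w : W) (x : (adelicGroupData F₀ E c 2 J).Adelic),
      ψ.toLinearMap (σ g w) x = ψ.toLinearMap w (x * finAdelicToAdelic F₀ E c 2 J g) := fun ψ g w x => by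
    show ψ (σ g w) x = ψ w _
    rw [Representation.IntertwiningMap.isIntertwining]
    rfl
  have heqvR : ∀ (ψ : σ.IntertwiningMap (rightRep₂ F₀ E c J)) (g : finAdelic F₀ E c 2 J) (w : W),
      ψ.toLinearMap (σ g w) = rightRep₂ F₀ E c J g (ψ.toLinearMap w) := fun ψ g w =>
    Representation.IntertwiningMap.isIntertwining _ _ ψ g w
  have hmem : ∀ (ψ : σ.IntertwiningMap (rightRep₂ F₀ E c J)), (∀ w, ψ w ∈ A) → ∀ w,
      MemLp (toQuotFun (adelicGroupData F₀ E c 2 J) (ψ w)) 2 μ := fun ψ hψ w =>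
    memLp_toQuotFun (hleft _ (hψ w)) (hcontA _ (hψ w))
  have hfin : ∀ (ψ : σ.IntertwiningMap (rightRep₂ F₀ E c J)) (hψ : ∀ w, ψ w ∈ A) (P : DiscreteAutomorphicRep (adelicGroupData F₀ E c 2 J) μ)
      (w : W), (∃ u ∈ P.space, ⟪(u : (adelicGroupData F₀ E c 2 J).L2 μ), (hmem ψ hψ w).toLp⟫_ℂ ≠ 0) → P.HasFinComponent σ :=
    fun ψ hψ P w hu => hasFinComponent_of_not_orthogonal P σ hσ ψ.toLinearMap (heqv ψ) (fun w => hleft _ (hψ w))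
      (fun w => hcontA _ (hψ w)) (hmem ψ hψ w) hu
  have htyp : ∀ (ψ : σ.IntertwiningMap (rightRep₂ F₀ E c J)) (hψ : ∀ w, ψ w ∈ A) (P : DiscreteAutomorphicRep (adelicGroupData F₀ E c 2 J) μ)
      (w : W), (∃ u ∈ P.space, ⟪(u : (adelicGroupData F₀ E c 2 J).L2 μ), (hmem ψ hψ w).toLp⟫_ℂ ≠ 0) → typeA P :=
    fun ψ hψ P w hu => hdet P (ψ w) (hψ w) (hmem ψ hψ w) hu
  -- THE `P₀`: an irreducible closed subspace meeting the class of a non-zero value of `ψ₁`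
  obtain ⟨w₁, hw₁⟩ : ∃ w, ψ₁ w ≠ 0 := by
    by_contra h
    push Not at h
    exact hψ₁0 (Representation.IntertwiningMap.ext (LinearMap.ext h))
  have hv₁ : (hmem ψ₁ hψ₁v w₁).toLp (toQuotFun (adelicGroupData F₀ E c 2 J) (ψ₁ w₁)) ≠ 0 :=
    toLp_toQuotFun_ne_zero (hleft _ (hψ₁v w₁)) (hcontA _ (hψ₁v w₁)) (hmem ψ₁ hψ₁v w₁) hw₁
  obtain ⟨W₀, hW₀irr, u₁, hu₁, hu₁v⟩ := exists_irreducible_not_orthogonal hdisc hv₁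
  let P₀ : DiscreteAutomorphicRep (adelicGroupData F₀ E c 2 J) μ := ⟨W₀, hW₀irr⟩
  have hP₀t : typeA P₀ := htyp ψ₁ hψ₁v P₀ w₁ ⟨u₁, hu₁, hu₁v⟩
  have hP₀f : P₀.HasFinComponent σ := hfin ψ₁ hψ₁v P₀ w₁ ⟨u₁, hu₁, hu₁v⟩
  -- every `A`-valued intertwiner is CONTAINED in `P₀` (§1: no multiplicity one needed)
  have hcont' : ∀ (ψ : σ.IntertwiningMap (rightRep₂ F₀ E c J)) (hψ : ∀ w, ψ w ∈ A) (w : W), P₀.ContainsFun (ψ w) :=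
    fun ψ hψ w => ⟨hmem ψ hψ w, mem_space_of_forall_detected_eq_of_isUnitary hdisc P₀ _ fun P hu =>
      huniq P P₀ (htyp ψ hψ P w hu) hP₀t (hfin ψ hψ P w hu) hP₀f⟩
  -- the isotypic line at `P₀`: `ψ = r • φ₀`, `ψ₁ = r₁ • φ₀` with `r₁ ≠ 0`
  obtain ⟨φ₀, hφ₀⟩ := hline P₀
  obtain ⟨r₁, hr₁⟩ := hφ₀ ψ₁.toLinearMap (heqvR ψ₁) fun w => ⟨hψ₁v w, hcont' ψ₁ hψ₁v w⟩
  have hr₁0 : r₁ ≠ 0 := by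
    rintro rfl
    apply hψ₁0
    apply Representation.IntertwiningMap.ext
    rw [hr₁, zero_smul]
    rfl
  refine ⟨ψ₁, fun ψ hψ => ?_⟩
  obtain ⟨r, hr⟩ := hφ₀ ψ.toLinearMap (heqvR ψ) fun w => ⟨hψ w, hcont' ψ hψ w⟩
  refine ⟨r * r₁⁻¹, Representation.IntertwiningMap.ext ?_⟩
  rw [Representation.IntertwiningMap.toLinearMap_smul, hr₁, smul_smul, mul_assoc, inv_mul_cancel₀ hr₁0, mul_one, hr]

end Core

end Summit.HodgeConjecture.HodgeConjecture.Cruxes.HLiu418.DetectedEqUnitary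

end
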